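import Literature.NumberTheory.LFunctions.RayClassLFunctionRealZeros
import Literature.NumberTheory.LFunctions.ClassGroupPairLSeries
import HarnessLib

/-!
# Deuring–Heilbronn for congruence class groups: the Dirichlet side and its non-negativity

Topic `Literature/NumberTheory/LFunctions` (namespace `Literature.NumberTheory.LFunctions`), the ray-class counterpart
of the tree's `ClassGroupPairLSeries.lean`.  Everything here is PROVED (one definition with body, `rayPairLSeries`,
and theorems).

For a modulus `𝔪 ≠ 0` of the number field `K` and a function `φ` on the primes with `|φ(𝔭)| ≤ 1` off `𝔪` (a ray
class character `mod 𝔪`), let `Λ^𝔪_φ = twistVonMangoldt K (rayClassCoeffHom 𝔪 φ)` be the coefficients of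
`−L_𝔪'/L_𝔪(s, φ)` (the IMPRIMITIVE `L`-function `mod 𝔪`: `Λ(𝔞)φ(𝔞)` on the ideals prime to `𝔪`, `0` elsewhere)
and

  `P_k(φ, s) = (1/k!) [ L((log)^k Λ^𝔪_φ, s) + L((log)^k Λ^𝔪_{φ̄}, s) ]`   (`rayPairLSeries`).

* `rayPairLSeries_eq_iteratedDeriv_logDeriv` — if `M`, `M'` are functions with `−M'/M = L(Λ^𝔪_φ, ·)` and
  `−M''/M' = L(Λ^𝔪_{φ̄}, ·)` on `Re s > 1`, then `P_k(φ, s) = ((−1)^{k+1}/k!) [(M'/M)^{(k)}(s) + (M''/M')^{(k)}(s)]`;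
* `re_rayPairLSeries_sum_nonneg` — **Deuring–Heilbronn positivity** [cite: ThornerZaman2017, §7.2]
  ("from the identity `0 ≤ (1 + ψ(𝔫))(1 + Re{χ(𝔫)(N𝔫)^{−it}})`"): for `φ₁` REAL (`φ₁(𝔭)² = 1` off `𝔪`), `φ`
  unimodular off `𝔪`, `σ > 1`, `t ∈ ℝ`, `k ∈ ℕ`:
  `0 ≤ Re [ P_k(1, σ) + P_k(φ₁, σ) + P_k(φ, σ + it) + P_k(φ₁φ, σ + it) ]`.
Since all four `L`-functions are taken imprimitive `mod 𝔪`, the `𝔫`-th coefficients vanish simultaneously off the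
ideals prime to `𝔪`, and the non-negativity is termwise [cite: LagariasMontgomeryOdlyzko1979, §4].

## References
* J. Thorner, A. Zaman, Algebra Number Theory 11 (2017), §7.2. [ThornerZaman2017]
* J. C. Lagarias, H. L. Montgomery, A. M. Odlyzko, Invent. Math. 54 (1979), §4. [LagariasMontgomeryOdlyzko1979]
-/

noncomputable section

open scoped NumberField LSeries.notation ComplexConjugate Classical
open Complex Filter Topology Set NumberField LSeries IsDedekindDomain

namespace Literature.NumberTheory.LFunctions

open Literature.NumberTheory.LFunctions.NumberField

variable {K : Type*} [Field K] [NumberField K]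
variable {𝔪 : Ideal (𝓞 K)}

/-! ### Summability -/

/-- The abscissa of absolute convergence of `Λ^𝔪_φ` is `≤ 1` (`|φ| ≤ 1` off `𝔪`). [cite: ThornerZaman2017, Lemma 2.2] -/
theorem abscissaOfAbsConv_twistVonMangoldt_rayClass_le (h𝔪 : 𝔪 ≠ ⊥) {φ : HeightOneSpectrum (𝓞 K) → ℂ}
    (hφ : ∀ v : HeightOneSpectrum (𝓞 K), ¬ 𝔪 ≤ v.asIdeal → ‖φ v‖ ≤ 1) :
    abscissaOfAbsConv (twistVonMangoldt K (rayClassCoeffHom 𝔪 φ)) ≤ 1 :=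
  LSeries.abscissaOfAbsConv_le_of_forall_lt_LSeriesSummable fun y hy =>
    LSeriesSummable_twistVonMangoldt (norm_rayClassCoeffHom_le h𝔪 hφ) (by simpa using hy)

/-- `(log)^k Λ^𝔪_φ` has an absolutely convergent `L`-series at `Re s > 1`. [cite: ThornerZaman2017, Lemma 2.2] -/
theorem LSeriesSummable_logPow_twistVonMangoldt_rayClass (h𝔪 : 𝔪 ≠ ⊥) {φ : HeightOneSpectrum (𝓞 K) → ℂ}
    (hφ : ∀ v : HeightOneSpectrum (𝓞 K), ¬ 𝔪 ≤ v.asIdeal → ‖φ v‖ ≤ 1) {s : ℂ} (hs : 1 < s.re) (k : ℕ) :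
    LSeriesSummable (fun n : ℕ ↦ Complex.log n ^ k * twistVonMangoldt K (rayClassCoeffHom 𝔪 φ) n) s := by
  rw [← logMul_iterate_eq]
  exact LSeriesSummable_of_abscissaOfAbsConv_lt_re
    (absicssaOfAbsConv_logPowMul.symm ▸ lt_of_le_of_lt (abscissaOfAbsConv_twistVonMangoldt_rayClass_le h𝔪 hφ)
      (by exact_mod_cast hs))

/-! ### The pair series -/

/-- **`P_k(φ, s) = (1/k!) [ L((log)^k Λ^𝔪_φ, s) + L((log)^k Λ^𝔪_{φ̄}, s) ]`**, the `k`-th derivative sum of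
`−L_𝔪'/L_𝔪(φ) − L_𝔪'/L_𝔪(φ̄)`. [cite: ThornerZaman2017, §7.2] -/
def rayPairLSeries (𝔪 : Ideal (𝓞 K)) (φ : HeightOneSpectrum (𝓞 K) → ℂ) (k : ℕ) (s : ℂ) : ℂ :=
  (1 / k.factorial : ℂ) *
    (LSeries (fun n : ℕ ↦ Complex.log n ^ k * twistVonMangoldt K (rayClassCoeffHom 𝔪 φ) n) s +
      LSeries (fun n : ℕ ↦ Complex.log n ^ k * twistVonMangoldt K (rayClassCoeffHom 𝔪 (fun v ↦ conj (φ v))) n) s)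

/-- From a logarithmic derivative: if `−M'/M = L(Λ^𝔪_φ, ·)` on `Re s > 1` then
`((−1)^{k+1}/k!) (M'/M)^{(k)}(s) = (1/k!) L((log)^k Λ^𝔪_φ, s)` for `Re s > 1`. [cite: ThornerZaman2017, Lemma 2.2] -/
theorem iteratedDeriv_logDeriv_eq_LSeries_logPow (h𝔪 : 𝔪 ≠ ⊥) {φ : HeightOneSpectrum (𝓞 K) → ℂ}
    (hφ : ∀ v : HeightOneSpectrum (𝓞 K), ¬ 𝔪 ≤ v.asIdeal → ‖φ v‖ ≤ 1) {M : ℂ → ℂ}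
    (hM : ∀ z : ℂ, 1 < z.re → -(deriv M z / M z) = LSeries (twistVonMangoldt K (rayClassCoeffHom 𝔪 φ)) z)
    {s : ℂ} (hs : 1 < s.re) (k : ℕ) :
    ((-1) ^ (k + 1) / k.factorial : ℂ) * iteratedDeriv k (logDeriv M) s =
      (1 / k.factorial : ℂ) * LSeries (fun n : ℕ ↦ Complex.log n ^ k * twistVonMangoldt K (rayClassCoeffHom 𝔪 φ) n) s := by
  have hU : IsOpen {z : ℂ | 1 < z.re} := isOpen_lt continuous_const continuous_re
  have hev : logDeriv M =ᶠ[𝓝 s] fun z ↦ -LSeries (twistVonMangoldt K (rayClassCoeffHom 𝔪 φ)) z := by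
    filter_upwards [hU.mem_nhds hs] with z hz
    rw [logDeriv_apply, ← hM z hz, neg_neg]
  rw [hev.iteratedDeriv_eq, iteratedDeriv_fun_neg,
    LSeries_iteratedDeriv k (lt_of_le_of_lt (abscissaOfAbsConv_twistVonMangoldt_rayClass_le h𝔪 hφ)
      (by exact_mod_cast hs)), logMul_iterate_eq]
  have hε : ((-1 : ℂ) ^ k) * (-1) ^ k = 1 := by rw [← mul_pow]; simp
  rw [pow_succ, div_eq_mul_inv, one_div]
  set L' : ℂ := LSeries (fun n : ℕ ↦ Complex.log n ^ k * twistVonMangoldt K (rayClassCoeffHom 𝔪 φ) n) s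
  linear_combination ((k.factorial : ℂ)⁻¹ * L') * hε

/-- **`P_k` from a pair of logarithmic derivatives**: if `−M'/M = L(Λ^𝔪_φ, ·)` and `−M̄'/M̄ = L(Λ^𝔪_{φ̄}, ·)` on
`Re s > 1`, then `P_k(φ, s) = ((−1)^{k+1}/k!) [(M'/M)^{(k)}(s) + (M̄'/M̄)^{(k)}(s)]`. [cite: ThornerZaman2017, Lemma 2.2] -/
theorem rayPairLSeries_eq_iteratedDeriv_logDeriv (h𝔪 : 𝔪 ≠ ⊥) {φ : HeightOneSpectrum (𝓞 K) → ℂ}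
    (hφ : ∀ v : HeightOneSpectrum (𝓞 K), ¬ 𝔪 ≤ v.asIdeal → ‖φ v‖ ≤ 1) {M M' : ℂ → ℂ}
    (hM : ∀ z : ℂ, 1 < z.re → -(deriv M z / M z) = LSeries (twistVonMangoldt K (rayClassCoeffHom 𝔪 φ)) z)
    (hM' : ∀ z : ℂ, 1 < z.re →
      -(deriv M' z / M' z) = LSeries (twistVonMangoldt K (rayClassCoeffHom 𝔪 (fun v ↦ conj (φ v)))) z)
    {s : ℂ} (hs : 1 < s.re) (k : ℕ) :
    rayPairLSeries 𝔪 φ k s = ((-1) ^ (k + 1) / k.factorial : ℂ) *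
      (iteratedDeriv k (logDeriv M) s + iteratedDeriv k (logDeriv M') s) := by
  have hφ' : ∀ v : HeightOneSpectrum (𝓞 K), ¬ 𝔪 ≤ v.asIdeal → ‖conj (φ v)‖ ≤ 1 := fun v hv ↦ by
    rw [Complex.norm_conj]; exact hφ v hv
  rw [mul_add, iteratedDeriv_logDeriv_eq_LSeries_logPow h𝔪 hφ hM hs k,
    iteratedDeriv_logDeriv_eq_LSeries_logPow h𝔪 hφ' hM' hs k, rayPairLSeries, mul_add]

/-! ### Non-negativity of the `n`-th term -/

/-- The coefficient of the principal character `mod 𝔪`: `1` on the nonzero ideals prime to `𝔪`, else `0`.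
[cite: ThornerZaman2017, §7.2] -/
theorem rayClassCoeff_one_eq (𝔪 I : Ideal (𝓞 K)) :
    rayClassCoeff 𝔪 (fun _ ↦ (1 : ℂ)) I = if I ≠ ⊥ ∧ IsCoprime I 𝔪 then 1 else 0 := by
  classical
  unfold rayClassCoeff
  split_ifs with h
  · unfold idealPow; exact finprod_eq_one_of_forall_eq_one fun v ↦ one_pow _
  · rfl

/-- The `n`-th term of the four-slot combination has non-negative real part:
`0 ≤ Re Σ_{N𝔞 = n} Λ(𝔞) (1 + φ₁(𝔞)) (2·1_𝔞⊥𝔪 + φ(𝔞)n^{−it} + φ̄(𝔞)n^{−it}) n^{−σ}`. [cite: ThornerZaman2017, §7.2] -/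
theorem re_rayPairTerm_nonneg (h𝔪 : 𝔪 ≠ ⊥) {φ₁ φ : HeightOneSpectrum (𝓞 K) → ℂ}
    (h₁ : ∀ v : HeightOneSpectrum (𝓞 K), ¬ 𝔪 ≤ v.asIdeal → φ₁ v ^ 2 = 1)
    (hφ : ∀ v : HeightOneSpectrum (𝓞 K), ¬ 𝔪 ≤ v.asIdeal → ‖φ v‖ ≤ 1) {σ : ℝ} (t : ℝ) (n : ℕ) :
    0 ≤ ((twistVonMangoldt K (rayClassCoeffHom 𝔪 (fun _ ↦ (1 : ℂ))) n +
          twistVonMangoldt K (rayClassCoeffHom 𝔪 (fun v ↦ conj ((fun _ ↦ (1 : ℂ)) v))) n +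
          (twistVonMangoldt K (rayClassCoeffHom 𝔪 φ₁) n +
            twistVonMangoldt K (rayClassCoeffHom 𝔪 (fun v ↦ conj (φ₁ v))) n)) * (n : ℂ) ^ (-(σ : ℂ)) +
        (twistVonMangoldt K (rayClassCoeffHom 𝔪 φ) n + twistVonMangoldt K (rayClassCoeffHom 𝔪 (fun v ↦ conj (φ v))) n +
          (twistVonMangoldt K (rayClassCoeffHom 𝔪 (fun v ↦ φ₁ v * φ v)) n +
            twistVonMangoldt K (rayClassCoeffHom 𝔪 (fun v ↦ conj (φ₁ v * φ v))) n)) *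
          (n : ℂ) ^ (-((σ : ℂ) + t * I))).re := by
  classical
  rcases Nat.eq_zero_or_pos n with rfl | hn
  · simp [twistVonMangoldt_zero]
  have hn0 : (n : ℂ) ≠ 0 := by exact_mod_cast hn.ne'
  -- `n^{−s} = n^{−σ} · w`, `w = n^{−it}`, `|w| = 1`
  set w : ℂ := (n : ℂ) ^ (-(t * I)) with hw
  have hw1 : ‖w‖ ≤ 1 := by
    rw [hw, Complex.norm_natCast_cpow_of_pos hn]; simp
  have hsplit : (n : ℂ) ^ (-((σ : ℂ) + t * I)) = (n : ℂ) ^ (-(σ : ℂ)) * w := by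
    rw [hw, show -((σ : ℂ) + t * I) = -(σ : ℂ) + -(t * I) by ring, Complex.cpow_add _ _ hn0]
  have hreal : (n : ℂ) ^ (-(σ : ℂ)) = (((n : ℝ) ^ (-σ) : ℝ) : ℂ) := by
    rw [Complex.ofReal_cpow (Nat.cast_nonneg n)]; push_cast; ring_nf
  have hpos : 0 ≤ (n : ℝ) ^ (-σ) := Real.rpow_nonneg (Nat.cast_nonneg n) _
  rw [hsplit, hreal]
  -- values of the coefficients on an ideal
  have hφ1' : ∀ v : HeightOneSpectrum (𝓞 K), ¬ 𝔪 ≤ v.asIdeal → ‖φ₁ v‖ ≤ 1 := fun v hv ↦ by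
    have h := h₁ v hv
    have : ‖φ₁ v‖ ^ 2 = 1 := by rw [← norm_pow, h, norm_one]
    nlinarith [norm_nonneg (φ₁ v)]
  -- the term of one ideal
  have key : ∀ I ∈ idealsOfNorm K n,
      0 ≤ (((idealVonMangoldt I * (n : ℝ) ^ (-σ) : ℝ) : ℂ) *
          ((1 + rayClassCoeff 𝔪 φ₁ I) *
            (2 * rayClassCoeff 𝔪 (fun _ ↦ (1 : ℂ)) I + rayClassCoeff 𝔪 φ I * w + conj (rayClassCoeff 𝔪 φ I) * w))).re := by
    intro I _
    rw [Complex.re_ofReal_mul]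
    refine mul_nonneg (mul_nonneg (idealVonMangoldt_nonneg I) hpos) ?_
    by_cases hI : I ≠ ⊥ ∧ IsCoprime I 𝔪
    · -- `a₁ ∈ {±1}`, principal coefficient `1`
      have h1c : rayClassCoeff 𝔪 (fun _ ↦ (1 : ℂ)) I = 1 := by rw [rayClassCoeff_one_eq, if_pos hI]
      have hsq : rayClassCoeffHom 𝔪 φ₁ I ^ 2 = 1 := by
        rw [← rayClassCoeffHom_sq, rayClassCoeffHom_apply, rayClassCoeff_congr h𝔪 h₁ I, h1c]
      rw [sq, mul_self_eq_one_iff] at hsq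
      have ha : rayClassCoeff 𝔪 φ₁ I = 0 ∨ rayClassCoeff 𝔪 φ₁ I = 1 ∨ rayClassCoeff 𝔪 φ₁ I = -1 := by
        rw [← rayClassCoeffHom_apply]; exact Or.inr hsq
      rw [h1c, mul_one]
      exact dh_trig_nonneg ha (norm_rayClassCoeff_le_one h𝔪 hφ I) hw1
    · have h0 : ∀ ψ : HeightOneSpectrum (𝓞 K) → ℂ, rayClassCoeff 𝔪 ψ I = 0 := fun ψ ↦ by
        unfold rayClassCoeff; rw [if_neg hI]
      simp [h0]
  -- expand over the ideals of norm `n`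
  have hconj1 : (fun v : HeightOneSpectrum (𝓞 K) ↦ conj ((fun _ ↦ (1 : ℂ)) v)) = fun _ ↦ (1 : ℂ) := by
    funext v; simp
  have ha : ∀ I, conj (rayClassCoeff 𝔪 φ₁ I) = rayClassCoeff 𝔪 φ₁ I := by
    intro I
    obtain ⟨h, -, -⟩ := rayClassCoeffHom_eq_re_of_real h𝔪 h₁ I
    rw [rayClassCoeffHom_apply] at h
    rw [h, Complex.conj_ofReal]
  rw [hconj1]
  simp only [twistVonMangoldt, rayClassCoeffHom_apply]
  simp only [add_mul, Finset.sum_mul, ← Finset.sum_add_distrib]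
  rw [Complex.re_sum]
  refine Finset.sum_nonneg fun I hI ↦ le_of_le_of_eq (key I hI) ?_
  congr 1
  have e1 : rayClassCoeff 𝔪 (fun v ↦ conj (φ₁ v)) I = rayClassCoeff 𝔪 φ₁ I := by rw [rayClassCoeff_conj, ha]
  have e2 : rayClassCoeff 𝔪 (fun v ↦ conj (φ v)) I = conj (rayClassCoeff 𝔪 φ I) := rayClassCoeff_conj 𝔪 φ I
  have e3 : rayClassCoeff 𝔪 (fun v ↦ φ₁ v * φ v) I = rayClassCoeff 𝔪 φ₁ I * rayClassCoeff 𝔪 φ I := by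
    have := rayClassCoeffHom_mul 𝔪 φ₁ φ I
    simpa only [rayClassCoeffHom_apply] using this
  have e4 : rayClassCoeff 𝔪 (fun v ↦ conj (φ₁ v * φ v)) I = rayClassCoeff 𝔪 φ₁ I * conj (rayClassCoeff 𝔪 φ I) := by
    rw [rayClassCoeff_conj, e3, map_mul, ha]
  -- the principal coefficient: `2 a₀ a₁ = 2 a₁`
  have e5 : rayClassCoeff 𝔪 (fun _ ↦ (1 : ℂ)) I * rayClassCoeff 𝔪 φ₁ I = rayClassCoeff 𝔪 φ₁ I := by
    by_cases hI0 : I ≠ ⊥ ∧ IsCoprime I 𝔪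
    · rw [rayClassCoeff_one_eq, if_pos hI0, one_mul]
    · have : rayClassCoeff 𝔪 φ₁ I = 0 := by unfold rayClassCoeff; rw [if_neg hI0]
      rw [this, mul_zero]
  rw [e1, e2, e3, e4]
  push_cast
  linear_combination (2 : ℂ) * ((idealVonMangoldt I : ℂ) * (((n : ℝ) ^ (-σ) : ℝ) : ℂ)) * e5

/-- **Deuring–Heilbronn positivity for a congruence class group**: for `φ₁` real (`φ₁(𝔭)² = 1` off `𝔪`), `φ`
with `|φ(𝔭)| ≤ 1` off `𝔪`, `σ > 1`, `t ∈ ℝ` and `k ∈ ℕ`: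
`0 ≤ Re [ P_k(1, σ) + P_k(φ₁, σ) + P_k(φ, σ + it) + P_k(φ₁φ, σ + it) ]`.
[cite: ThornerZaman2017, §7.2] [cite: LagariasMontgomeryOdlyzko1979, §4] -/
theorem re_rayPairLSeries_sum_nonneg (h𝔪 : 𝔪 ≠ ⊥) {φ₁ φ : HeightOneSpectrum (𝓞 K) → ℂ}
    (h₁ : ∀ v : HeightOneSpectrum (𝓞 K), ¬ 𝔪 ≤ v.asIdeal → φ₁ v ^ 2 = 1)
    (hφ : ∀ v : HeightOneSpectrum (𝓞 K), ¬ 𝔪 ≤ v.asIdeal → ‖φ v‖ ≤ 1) {σ : ℝ} (hσ : 1 < σ) (t : ℝ) (k : ℕ) :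
    0 ≤ (rayPairLSeries 𝔪 (fun _ ↦ (1 : ℂ)) k σ + rayPairLSeries 𝔪 φ₁ k σ + rayPairLSeries 𝔪 φ k (σ + t * I) +
      rayPairLSeries 𝔪 (fun v ↦ φ₁ v * φ v) k (σ + t * I)).re := by
  have hσ' : 1 < (σ : ℂ).re := by simpa using hσ
  have hs' : 1 < ((σ : ℂ) + t * I).re := by simpa using hσ
  have hφ1' : ∀ v : HeightOneSpectrum (𝓞 K), ¬ 𝔪 ≤ v.asIdeal → ‖φ₁ v‖ ≤ 1 := fun v hv ↦ by
    have h := h₁ v hv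
    have : ‖φ₁ v‖ ^ 2 = 1 := by rw [← norm_pow, h, norm_one]
    nlinarith [norm_nonneg (φ₁ v)]
  -- every character in sight is bounded by `1` off `𝔪`
  have hb : ∀ ψ : HeightOneSpectrum (𝓞 K) → ℂ, (∀ v : HeightOneSpectrum (𝓞 K), ¬ 𝔪 ≤ v.asIdeal → ‖ψ v‖ ≤ 1) →
      ∀ v : HeightOneSpectrum (𝓞 K), ¬ 𝔪 ≤ v.asIdeal → ‖conj (ψ v)‖ ≤ 1 := fun ψ hψ v hv ↦ by
    rw [Complex.norm_conj]; exact hψ v hv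
  have hone : ∀ v : HeightOneSpectrum (𝓞 K), ¬ 𝔪 ≤ v.asIdeal → ‖(fun _ : HeightOneSpectrum (𝓞 K) ↦ (1 : ℂ)) v‖ ≤ 1 :=
    fun v _ ↦ by simp
  have hprod : ∀ v : HeightOneSpectrum (𝓞 K), ¬ 𝔪 ≤ v.asIdeal → ‖φ₁ v * φ v‖ ≤ 1 := fun v hv ↦ by
    rw [norm_mul]; exact mul_le_one₀ (hφ1' v hv) (norm_nonneg _) (hφ v hv)
  -- each `L`-series as a `tsum` of terms
  set T : (HeightOneSpectrum (𝓞 K) → ℂ) → ℂ → ℕ → ℂ := fun ψ s n ↦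
    term (fun n : ℕ ↦ Complex.log n ^ k * twistVonMangoldt K (rayClassCoeffHom 𝔪 ψ) n) s n with hT
  have hS : ∀ (ψ : HeightOneSpectrum (𝓞 K) → ℂ), (∀ v : HeightOneSpectrum (𝓞 K), ¬ 𝔪 ≤ v.asIdeal → ‖ψ v‖ ≤ 1) →
      ∀ s : ℂ, 1 < s.re →
      HasSum (T ψ s) (LSeries (fun n : ℕ ↦ Complex.log n ^ k * twistVonMangoldt K (rayClassCoeffHom 𝔪 ψ) n) s) :=
    fun ψ hψ s hs ↦ (LSeriesSummable_logPow_twistVonMangoldt_rayClass h𝔪 hψ hs k).hasSum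
  have hP : ∀ (ψ : HeightOneSpectrum (𝓞 K) → ℂ), (∀ v : HeightOneSpectrum (𝓞 K), ¬ 𝔪 ≤ v.asIdeal → ‖ψ v‖ ≤ 1) →
      ∀ s : ℂ, 1 < s.re →
      HasSum (fun n ↦ (1 / k.factorial : ℂ) * (T ψ s n + T (fun v ↦ conj (ψ v)) s n)) (rayPairLSeries 𝔪 ψ k s) :=
    fun ψ hψ s hs ↦ ((hS ψ hψ s hs).add (hS _ (hb ψ hψ) s hs)).mul_left _
  have hFsum := (((hP _ hone σ hσ').add (hP φ₁ hφ1' σ hσ')).add (hP φ hφ (σ + t * I) hs')).add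
    (hP (fun v ↦ φ₁ v * φ v) hprod (σ + t * I) hs')
  have hk : (0 : ℝ) < 1 / k.factorial := by positivity
  rw [← hFsum.tsum_eq, Complex.re_tsum hFsum.summable]
  refine tsum_nonneg fun n ↦ ?_
  -- the `n`-th term
  rcases Nat.eq_zero_or_pos n with rfl | hn
  · simp [hT]
  have hterm : ∀ (ψ : HeightOneSpectrum (𝓞 K) → ℂ) (s : ℂ), T ψ s n =
      Complex.log n ^ k * twistVonMangoldt K (rayClassCoeffHom 𝔪 ψ) n * (n : ℂ) ^ (-s) := by
    intro ψ s
    rw [hT]; dsimp only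
    rw [term_of_ne_zero hn.ne', div_eq_mul_inv, ← Complex.cpow_neg]
  simp only [hterm]
  have hlog : (Complex.log n ^ k : ℂ) = (((Real.log n) ^ k : ℝ) : ℂ) := by
    rw [← Complex.natCast_log]; push_cast; rfl
  have hlog0 : 0 ≤ (Real.log n) ^ k := pow_nonneg (Real.log_natCast_nonneg n) k
  have hmain := re_rayPairTerm_nonneg h𝔪 h₁ hφ (σ := σ) t n
  -- factor `(1/k!)(log n)^k` out
  set c₀ := twistVonMangoldt K (rayClassCoeffHom 𝔪 (fun _ ↦ (1 : ℂ))) n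
  set c₀' := twistVonMangoldt K (rayClassCoeffHom 𝔪 (fun v ↦ conj ((fun _ : HeightOneSpectrum (𝓞 K) ↦ (1 : ℂ)) v))) n
  set c₁ := twistVonMangoldt K (rayClassCoeffHom 𝔪 φ₁) n
  set c₁' := twistVonMangoldt K (rayClassCoeffHom 𝔪 (fun v ↦ conj (φ₁ v))) n
  set c₂ := twistVonMangoldt K (rayClassCoeffHom 𝔪 φ) n
  set c₂' := twistVonMangoldt K (rayClassCoeffHom 𝔪 (fun v ↦ conj (φ v))) n
  set c₃ := twistVonMangoldt K (rayClassCoeffHom 𝔪 (fun v ↦ φ₁ v * φ v)) n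
  set c₃' := twistVonMangoldt K (rayClassCoeffHom 𝔪 (fun v ↦ conj (φ₁ v * φ v))) n
  have heq : (1 / k.factorial : ℂ) *
        (Complex.log n ^ k * c₀ * (n : ℂ) ^ (-(σ : ℂ)) + Complex.log n ^ k * c₀' * (n : ℂ) ^ (-(σ : ℂ))) +
      (1 / k.factorial : ℂ) *
        (Complex.log n ^ k * c₁ * (n : ℂ) ^ (-(σ : ℂ)) + Complex.log n ^ k * c₁' * (n : ℂ) ^ (-(σ : ℂ))) +
      (1 / k.factorial : ℂ) *
        (Complex.log n ^ k * c₂ * (n : ℂ) ^ (-((σ : ℂ) + t * I)) +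
          Complex.log n ^ k * c₂' * (n : ℂ) ^ (-((σ : ℂ) + t * I))) +
      (1 / k.factorial : ℂ) *
        (Complex.log n ^ k * c₃ * (n : ℂ) ^ (-((σ : ℂ) + t * I)) +
          Complex.log n ^ k * c₃' * (n : ℂ) ^ (-((σ : ℂ) + t * I))) =
      (((1 / k.factorial * (Real.log n) ^ k : ℝ)) : ℂ) *
        ((c₀ + c₀' + (c₁ + c₁')) * (n : ℂ) ^ (-(σ : ℂ)) +
          (c₂ + c₂' + (c₃ + c₃')) * (n : ℂ) ^ (-((σ : ℂ) + t * I))) := by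
    rw [hlog]; push_cast; ring
  rw [heq, Complex.re_ofReal_mul]
  exact mul_nonneg (mul_nonneg hk.le hlog0) hmain

end Literature.NumberTheory.LFunctions

end
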